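import Mathlib
import Summits.Ventures.PercRepro2.SwOutWeakCubeBlocks
import Summits.Ventures.PercRepro2.SwAllMarkStepDeco

/-!
# THE ROW FROM WEAK CUBES ON THE WHOLE SIDE: no fibration (blind cell PercRepro2, night-4 g38,
2026-08-29; proofs/NIGHT4-G38.md §4)

g36's `rigidOK_g_of_weakCubes` takes a part `P` of the general doubly typed side; with `P` the
whole side the block decomposition may cross the fibres of the escaping set — a weak cube needs no
roots, so the fibration of SwOutFrozenBaseGRow / SwOutWeakCubeRow is not needed for it.  This file:
`WeakCubeSide` (a key and a block function on the side of a class: every side point in its block,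
every typed point of a block in the side with the same key, every block an injective weak cube with
the lower set, the red edge set of `h` increasing and the antipode containment at the typed points),
`rigidOK_g_of_weakCubeSide`, `gTypedSwAll_of_weakCubeSide` and THE ROW
**`swAll_markStep_of_weakCubeSide`** / `sw_markStep_of_weakCubeSide`.  The census
(mining/night-4/g38/fzcover.py with WHOLESIDE=1) certifies the hypothesis class by class: at
`n = 7` the 19 fibres of the 456 open pairs that have no fibre-consistent weak-cube cover with at
most three coordinates are covered once the blocks may cross the fibres.
-/

namespace Summit.Ventures.PercRepro2

namespace LocRows

open Hull

universe u v

variable {V : Type u} {E : Type v} [Fintype E] [DecidableEq E]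

open scoped Classical

variable {ends : E → Sym2 V} {U : Set V} {ξ : Config E} {l h : V}
  {𝓤 𝓓 𝓓'' : Set (Set V)} {X : Set V} {𝓤' : Set (Set V)}

/-- **The weak-cube block structure of the whole side of a class**: a key and a block function;
every side point lies in its block; every typed point of a block lies in the side with the same
key; every block is the image of an injective cube realisation on which the typed side pulls back
to a lower set, the red edge set of `h` is increasing, and the red edges of `h` at the antipode of
a typed point are blue edges of `h` at the point. -/
def WeakCubeSide (ends : E → Sym2 V) (l h : V) (𝓤 𝓓 𝓓'' : Set (Set V)) (X : Set V)
    (𝓤' : Set (Set V)) (U : Set V) (ξ : Config E) : Prop :=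
  ∃ (K : Type v) (key : Config E → K) (block : K → Finset (Config E)),
    (∀ ζ ∈ gOutSide ends l h 𝓤 𝓓 𝓓'' X 𝓤' U ξ, ζ ∈ block (key ζ)) ∧
    (∀ ζ ∈ gOutSide ends l h 𝓤 𝓓 𝓓'' X 𝓤' U ξ, ∀ ζ' ∈ block (key ζ),
      ζ' ∈ gTypedQ ends l h 𝓤 𝓓 𝓓'' X 𝓤' →
        ζ' ∈ gOutSide ends l h 𝓤 𝓓 𝓓'' X 𝓤' U ξ ∧ key ζ' = key ζ) ∧
    (∀ ζ ∈ gOutSide ends l h 𝓤 𝓓 𝓓'' X 𝓤' U ξ,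
      ∃ (E' : Type v) (_ : Fintype E') (_ : DecidableEq E') (r : Config E' → Config E),
        Function.Injective r ∧ (∀ ζ', ζ' ∈ block (key ζ) ↔ ∃ ω, r ω = ζ') ∧
          IsLowerSet {ω | r ω ∈ gTypedQ ends l h 𝓤 𝓓 𝓓'' X 𝓤'} ∧
          (∀ 𝓔 : Set (Set E), IsUpperSet 𝓔 → IsUpperSet {ω | redEdges ends (r ω) h ∈ 𝓔}) ∧
          (∀ ω, r ω ∈ gTypedQ ends l h 𝓤 𝓓 𝓓'' X 𝓤' →
            redEdges ends (r (flipAll ω)) h ⊆ blueEdges ends (r ω) h))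

/-- **The rigid inequality on the whole side from weak cubes** (g36's `rigidOK_g_of_weakCubes`
with the part `P = True`). -/
theorem rigidOK_g_of_weakCubeSide (hws : WeakCubeSide ends l h 𝓤 𝓓 𝓓'' X 𝓤' U ξ)
    {𝓔 : Set (Set E)} (h𝓔 : IsUpperSet 𝓔) :
    ((gOutSide ends l h 𝓤 𝓓 𝓓'' X 𝓤' U ξ).filter fun ζ => redEdges ends ζ h ∈ 𝓔).card ≤
      ((gOutSide ends l h 𝓤 𝓓 𝓓'' X 𝓤' U ξ).filter fun ζ => blueEdges ends ζ h ∈ 𝓔).card := by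
  obtain ⟨K, key, block, hmem, hblock, hcube⟩ := hws
  have main := rigidOK_g_of_weakCubes (ends := ends) (U := U) (ξ := ξ) (l := l) (h := h)
    (𝓤 := 𝓤) (𝓓 := 𝓓) (𝓓'' := 𝓓'') (X := X) (𝓤' := 𝓤') key block (fun _ => True)
    (fun ζ hζ _ => hmem ζ hζ)
    (fun ζ hζ _ ζ' hζ' hQ => ⟨(hblock ζ hζ ζ' hζ' hQ).1, trivial, (hblock ζ hζ ζ' hζ' hQ).2⟩)
    (fun ζ hζ _ => hcube ζ hζ) h𝓔
  simpa only [true_and] using main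

/-- **The general doubly typed row from weak cubes on the side of every class.** -/
theorem gTypedSwAll_of_weakCubeSide (hlh : l ≠ h)
    (hws : ∀ ξ, WeakCubeSide ends l h 𝓤 𝓓 𝓓'' X 𝓤' ({l}ᶜ) ξ) :
    GTypedSwAll ends l h 𝓤 𝓓 𝓓'' X 𝓤' :=
  exists_swAll_injection_of_card_le h _ (card_le_g_of_classes hlh fun ξ _ h𝓔 =>
    rigidOK_g_of_weakCubeSide (hws ξ) h𝓔)

section MarkStep

variable {x : V}

/-- **THE GENERAL MARK STEP FROM WEAK CUBES ON THE WHOLE SIDE**: row 2′SW-ALL with the mark `x`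
on every graph under the weak-cube block structure on the side of every class of every pattern of
the mark's edges. -/
theorem swAll_markStep_of_weakCubeSide (hxl : x ≠ l) (hxh : x ≠ h) (hlh : l ≠ h)
    (hws : ∀ d : Config E, ∀ ξ, WeakCubeSide (isolate ends x) l h (markU ends d x)
      (markD ends d x) (markD'' ends d x) {x} Set.univ ({l}ᶜ) ξ) :
    SwAll ends l h x := by
  refine swAll_of_gTyped_patterns hxl hxh fun d _ => ?_
  exact gTypedSwAll_of_weakCubeSide hlh (hws d)

/-- **Row (SW) from the general mark step from weak cubes on the whole side.** -/
theorem sw_markStep_of_weakCubeSide (hxl : x ≠ l) (hxh : x ≠ h) (hlh : l ≠ h)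
    (hws : ∀ d : Config E, ∀ ξ, WeakCubeSide (isolate ends x) l h (markU ends d x)
      (markD ends d x) (markD'' ends d x) {x} Set.univ ({l}ᶜ) ξ) :
    Sw ends l h x :=
  sw_of_swAll ends (swAll_markStep_of_weakCubeSide hxl hxh hlh hws)

end MarkStep

end LocRows

end Summit.Ventures.PercRepro2
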